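import Summits.CriticalPhenomena.Ising3DConformalLimit.Theses.OctaveForgetting
import Literature.Probability.LatticeModels.PlusMinusStateGibbs
import HarnessLib

/-!
# `OctaveForgetting.EtaFromForgetting2` (item stmt-CriticalPhenomena-14438), proved

THEOREM-ONLY file (no definitions, no named facts). The glue item of route `OctaveForgetting`:
`SphereForgetting → ForgettingComposes → SphereCovarianceLowerBound → SphereVarianceUpperBound →
Target` (the three middle hypotheses inlined verbatim by the gate's render). Proof: fix the plus
state `μ⁺ ∈ 𝒢(β_c(3))` (`exists_plusMeasure_holds`); with `r₁ = max r₀ R₀`, `R_k = L^k r₁` and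
`g = ∑_{y ∈ S_{R_k}} σ_y`, the chain `c²R⁴G(3Re₁)² ≤ Cov² ≤ θ^k·Var σ₀·Var g ≤ θ^k·C·R³` gives
`G(3R_k e₁)² ≤ (C/c²) θ^k / L^k`; since `θL < 1`, `θ^k/L^k ≤ ρ^k/L^{2k}` with
`ρ = max(θL, 1/2) < 1`, i.e. `G(3R_k e₁) ≤ A (L^k)^{-(1+κ)}` with `κ = -log ρ /(2 log L) > 0`;
the Messager–Miracle-Solé monotonicity `⟨σ₀σ_z⟩ ≤ ⟨σ₀σ_w⟩` for `3‖w‖_∞ ≤ ‖z‖_∞`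
(`twoPointFree_le_of_mul_supNorm_le`, transferred to the plus state at `β_c` by
`twoPointPlus_criticalBeta_eq_twoPointFree_holds`) and `k = ⌊log_L(‖x‖_∞/9r₁)⌋` give
`G(x) ≤ C'‖x‖^{-(1+κ)}` for `‖x‖_∞ ≥ 9r₁`, and `G ≤ 1` covers the finitely many small `x`.

References: A. Messager, S. Miracle-Solé, J. Stat. Phys. 17 (1977) 245; H. Duminil-Copin,
*Lectures on the Ising and Potts models on the hypercubic lattice* (2019), §4.3–4.4;
H. S. Witsenhausen, SIAM J. Appl. Math. 28 (1975) 100 (the product rule behind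
`ForgettingComposes`, not used here).
-/

noncomputable section

namespace Summit.CriticalPhenomena.Ising3DConformalLimit.Theorems

open Literature.Probability.LatticeModels MeasureTheory Finset
open scoped BigOperators
open Summit.CriticalPhenomena.Ising3DConformalLimit.Theses

/-- The sup norm of `m e₁ ∈ ℤ³` for an integer `m` is `|m|`. [folklore] -/
theorem etaFromForgetting_supNorm_single (m : ℤ) :
    Site.supNorm (Pi.single (0 : Fin 3) m : Site 3) = m.natAbs := by
  apply le_antisymm
  · rw [Site.supNorm_le_iff]
    intro j
    by_cases hj : j = 0
    · subst hj; simp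
    · rw [Pi.single_eq_of_ne hj]; simp
  · have := Site.natAbs_le_supNorm (Pi.single (0 : Fin 3) m : Site 3) 0
    simpa using this

/-- A finite sum of spins `∑_{y ∈ s} σ_y` depends only on the spins in any set containing `s`.
[folklore] -/
theorem etaFromForgetting_dependsOn_sum_spinAt (s : Finset (Site 3)) (S : Set (Site 3))
    (h : ∀ y ∈ s, y ∈ S) :
    DependsOn (fun σ : SpinConfig (Site 3) => ∑ y ∈ s, spinAt y σ) S := by
  intro σ τ hστ
  refine Finset.sum_congr rfl fun y hy => ?_
  simp only [spinAt, hστ y (h y hy)]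

/-- For a probability measure, `Var σ₀ = ∫ σ₀² - (∫ σ₀)² ∈ [0, 1]` (spins are `±1`). [folklore] -/
theorem etaFromForgetting_var_spinAt_mem (μ : Measure (SpinConfig (Site 3))) [IsProbabilityMeasure μ]
    (x : Site 3) :
    0 ≤ ∫ σ, spinAt x σ ^ 2 ∂μ - (∫ σ, spinAt x σ ∂μ) ^ 2 ∧
      ∫ σ, spinAt x σ ^ 2 ∂μ - (∫ σ, spinAt x σ ∂μ) ^ 2 ≤ 1 := by
  have h1 : ∫ σ, spinAt x σ ^ 2 ∂μ = 1 := by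
    simp only [spinAt_sq, integral_const, smul_eq_mul, mul_one, probReal_univ]
  have h2 : |∫ σ, spinAt x σ ∂μ| ≤ 1 := by
    refine (abs_integral_le_integral_abs).trans ?_
    simp only [abs_spinAt, integral_const, smul_eq_mul, mul_one, probReal_univ, le_refl]
  rw [h1]
  have h3 : (∫ σ, spinAt x σ ∂μ) ^ 2 ≤ 1 := by
    have := abs_le.1 h2
    nlinarith [this.1, this.2]
  constructor
  · linarith
  · nlinarith [sq_nonneg (∫ σ, spinAt x σ ∂μ)]

/-- Geometric-to-power-law conversion: if `a_k ≥ 0`, `a_k² ≤ D θ^k / L^k` with `θ L < 1`, `L ≥ 2`,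
then `a_k ≤ A (L^k)^{-(1+κ)}` for some `κ > 0`, `A ≥ 0` (`ρ = max(θL, 1/2)`,
`κ = -log ρ / (2 log L)`). [folklore] -/
theorem etaFromForgetting_decay_of_geometric {L : ℕ} (hL : 2 ≤ L) {θ D : ℝ} (hθ : 0 ≤ θ)
    (hθL : θ * L < 1) (hD : 0 ≤ D) {a : ℕ → ℝ} (ha0 : ∀ k, 0 ≤ a k)
    (ha : ∀ k, a k ^ 2 ≤ D * θ ^ k / (L : ℝ) ^ k) :
    ∃ κ : ℝ, 0 < κ ∧ ∃ A : ℝ, 0 ≤ A ∧ ∀ k, a k ≤ A * ((L : ℝ) ^ k) ^ (-(1 + κ)) := by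
  have hLpos : (0 : ℝ) < L := by exact_mod_cast (by omega : 0 < L)
  have hL1 : (1 : ℝ) < L := by exact_mod_cast (by omega : 1 < L)
  set ρ : ℝ := max (θ * L) (1 / 2) with hρ
  have hρ0 : 0 < ρ := lt_of_lt_of_le (by norm_num) (le_max_right _ _)
  have hρ1 : ρ < 1 := max_lt hθL (by norm_num)
  have hlogL : 0 < Real.log L := Real.log_pos hL1
  have hlogρ : Real.log ρ < 0 := Real.log_neg hρ0 hρ1
  set κ : ℝ := -Real.log ρ / (2 * Real.log L) with hκ
  have hκ0 : 0 < κ := by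
    rw [hκ]
    apply div_pos <;> linarith
  -- θ ≤ ρ / L
  have hθρ : θ ≤ ρ / L := by
    rw [le_div_iff₀ hLpos]
    exact le_max_left _ _
  -- ρ^k = (L^k)^(-2κ)
  have hρpow : ∀ k : ℕ, ρ ^ k = ((L : ℝ) ^ k) ^ (-(2 * κ)) := by
    intro k
    have hLk : (0 : ℝ) < (L : ℝ) ^ k := pow_pos hLpos k
    rw [Real.rpow_def_of_pos hLk, Real.log_pow]
    have : (k : ℝ) * Real.log L * (-(2 * κ)) = k * Real.log ρ := by
      rw [hκ]
      field_simp
    rw [this, Real.exp_nat_mul, Real.exp_log hρ0]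
  refine ⟨κ, hκ0, Real.sqrt D, Real.sqrt_nonneg D, fun k => ?_⟩
  have hLk : (0 : ℝ) < (L : ℝ) ^ k := pow_pos hLpos k
  set t : ℝ := (L : ℝ) ^ k with ht
  -- a k ^ 2 ≤ D * ρ^k / t^2
  have h1 : a k ^ 2 ≤ D * ρ ^ k / t ^ 2 := by
    refine (ha k).trans ?_
    have hθk : θ ^ k ≤ (ρ / L) ^ k := pow_le_pow_left₀ hθ hθρ k
    rw [div_pow] at hθk
    calc D * θ ^ k / t = D * (θ ^ k / t) := by ring
      _ ≤ D * (ρ ^ k / t / t) := by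
          apply mul_le_mul_of_nonneg_left _ hD
          exact div_le_div_of_nonneg_right hθk hLk.le
      _ = D * ρ ^ k / t ^ 2 := by ring
  have h2 : D * ρ ^ k / t ^ 2 = (Real.sqrt D * t ^ (-(1 + κ))) ^ 2 := by
    rw [mul_pow, Real.sq_sqrt hD, hρpow k]
    have e1 : (t ^ (-(1 + κ))) ^ 2 = t ^ (-(2 * κ)) / t ^ 2 := by
      rw [← Real.rpow_natCast (t ^ (-(1 + κ))) 2, ← Real.rpow_mul hLk.le]
      have : (-(1 + κ)) * ((2 : ℕ) : ℝ) = -(2 * κ) + -(2 : ℝ) := by push_cast; ring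
      rw [this, Real.rpow_add hLk, Real.rpow_neg hLk.le 2]
      rw [show (t ^ (2 : ℝ)) = t ^ (2 : ℕ) from by rw [← Real.rpow_natCast]; norm_num]
      ring
    rw [e1]
    ring
  rw [h2] at h1
  have hnonneg : 0 ≤ Real.sqrt D * t ^ (-(1 + κ)) :=
    mul_nonneg (Real.sqrt_nonneg D) (Real.rpow_nonneg hLk.le _)
  exact (pow_le_pow_iff_left₀ (ha0 k) hnonneg (by norm_num : (2 : ℕ) ≠ 0)).1 h1

/-- From decay along the axis points `3 L^k r₁ e₁` to a power law at every `x ≠ 0`, for any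
`G : ℤ³ → [0,1]` which is Messager–Miracle-Solé monotone (`G z ≤ G w` whenever
`3‖w‖_∞ ≤ ‖z‖_∞`). [folklore] -/
theorem etaFromForgetting_powerlaw_of_axis_decay (G : Site 3 → ℝ) (hG1 : ∀ x, G x ≤ 1)
    (hmono : ∀ z w : Site 3, 3 * Site.supNorm w ≤ Site.supNorm z → G z ≤ G w)
    {L r₁ : ℕ} (hL : 2 ≤ L) (hr₁ : 1 ≤ r₁) {A κ : ℝ} (hA : 0 ≤ A) (hκ : 0 < κ)
    (hdec : ∀ k : ℕ, G (Pi.single 0 (3 * ((L ^ k * r₁ : ℕ) : ℤ))) ≤ A * ((L : ℝ) ^ k) ^ (-(1 + κ))) :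
    ∃ C : ℝ, ∀ x : Site 3, x ≠ 0 → G x ≤ C * (‖x‖ : ℝ) ^ (-(1 + κ)) := by
  have hLpos : (0 : ℝ) < L := by exact_mod_cast (by omega : 0 < L)
  set B : ℝ := 9 * r₁ * L with hB
  have hr₁pos : (0 : ℝ) < 9 * r₁ := by
    have : (1 : ℝ) ≤ r₁ := by exact_mod_cast hr₁
    linarith
  have hBpos : 0 < B := mul_pos hr₁pos hLpos
  have hexp : -(1 + κ) ≤ 0 := by linarith
  refine ⟨A * B ^ (1 + κ) + (9 * r₁ : ℝ) ^ (1 + κ), fun x hx => ?_⟩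
  set n : ℕ := Site.supNorm x with hn
  have hn0 : n ≠ 0 := fun h => hx (Site.supNorm_eq_zero_iff.1 h)
  have hn1 : (1 : ℝ) ≤ n := by exact_mod_cast Nat.one_le_iff_ne_zero.2 hn0
  have hnpos : (0 : ℝ) < n := by linarith
  rw [Site.norm_eq_supNorm, ← hn]
  have hsmall_term : 0 ≤ (9 * r₁ : ℝ) ^ (1 + κ) := Real.rpow_nonneg hr₁pos.le _
  have hbig_term : 0 ≤ A * B ^ (1 + κ) := mul_nonneg hA (Real.rpow_nonneg hBpos.le _)
  have hnpow : 0 ≤ (n : ℝ) ^ (-(1 + κ)) := Real.rpow_nonneg hnpos.le _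
  by_cases hsmall : n < 9 * r₁
  · -- small x: G x ≤ 1 ≤ (9 r₁)^(1+κ) n^(-(1+κ))
    have hle : (n : ℝ) ≤ 9 * r₁ := by exact_mod_cast hsmall.le
    have h1 : (9 * r₁ : ℝ) ^ (-(1 + κ)) ≤ (n : ℝ) ^ (-(1 + κ)) :=
      Real.rpow_le_rpow_of_nonpos hnpos hle hexp
    have h2 : (9 * r₁ : ℝ) ^ (1 + κ) * (9 * r₁ : ℝ) ^ (-(1 + κ)) = 1 := by
      rw [Real.rpow_neg hr₁pos.le, mul_inv_cancel₀ (Real.rpow_pos_of_pos hr₁pos _).ne']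
    calc G x ≤ 1 := hG1 x
      _ = (9 * r₁ : ℝ) ^ (1 + κ) * (9 * r₁ : ℝ) ^ (-(1 + κ)) := h2.symm
      _ ≤ (9 * r₁ : ℝ) ^ (1 + κ) * (n : ℝ) ^ (-(1 + κ)) :=
          mul_le_mul_of_nonneg_left h1 hsmall_term
      _ ≤ (A * B ^ (1 + κ) + (9 * r₁ : ℝ) ^ (1 + κ)) * (n : ℝ) ^ (-(1 + κ)) := by
          nlinarith
  · -- large x: pick k = ⌊log_L (n / 9r₁)⌋
    push Not at hsmall
    set m : ℕ := n / (9 * r₁) with hm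
    have h9r₁ : 0 < 9 * r₁ := by omega
    have hm1 : 1 ≤ m := (Nat.one_le_div_iff h9r₁).2 hsmall
    set k : ℕ := Nat.log L m with hk
    have hLk : L ^ k ≤ m := Nat.pow_log_le_self L (by omega)
    have hmlt : m < L ^ (k + 1) := Nat.lt_pow_succ_log_self (by omega) m
    have hkm : 9 * r₁ * L ^ k ≤ n := by
      calc 9 * r₁ * L ^ k ≤ 9 * r₁ * m := Nat.mul_le_mul_left _ hLk
        _ = m * (9 * r₁) := by ring
        _ ≤ n := Nat.div_mul_le_self n (9 * r₁)
    have hnlt : n < 9 * r₁ * L ^ (k + 1) := by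
      have h1 : n < m * (9 * r₁) + 9 * r₁ := Nat.lt_div_mul_add h9r₁
      calc n < m * (9 * r₁) + 9 * r₁ := h1
        _ = 9 * r₁ * (m + 1) := by ring
        _ ≤ 9 * r₁ * L ^ (k + 1) := Nat.mul_le_mul_left _ hmlt
    -- MMS monotonicity
    have hmono' : G x ≤ G (Pi.single 0 (3 * ((L ^ k * r₁ : ℕ) : ℤ))) := by
      apply hmono
      rw [show (3 * ((L ^ k * r₁ : ℕ) : ℤ)) = ((3 * (L ^ k * r₁) : ℕ) : ℤ) by push_cast; ring,
        etaFromForgetting_supNorm_single, Int.natAbs_natCast]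
      calc 3 * (3 * (L ^ k * r₁)) = 9 * r₁ * L ^ k := by ring
        _ ≤ n := hkm
    have hLkpos : (0 : ℝ) < (L : ℝ) ^ k := pow_pos hLpos k
    -- n / B < L^k
    have hnB : (n : ℝ) / B ≤ (L : ℝ) ^ k := by
      rw [div_le_iff₀ hBpos, hB]
      have : (n : ℝ) < 9 * r₁ * L ^ (k + 1) := by exact_mod_cast hnlt
      calc (n : ℝ) ≤ 9 * r₁ * L ^ (k + 1) := this.le
        _ = (L : ℝ) ^ k * (9 * r₁ * L) := by ring
    have hnBpos : 0 < (n : ℝ) / B := div_pos hnpos hBpos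
    have h1 : ((L : ℝ) ^ k) ^ (-(1 + κ)) ≤ ((n : ℝ) / B) ^ (-(1 + κ)) :=
      Real.rpow_le_rpow_of_nonpos hnBpos hnB hexp
    have h2 : ((n : ℝ) / B) ^ (-(1 + κ)) = B ^ (1 + κ) * (n : ℝ) ^ (-(1 + κ)) := by
      rw [Real.div_rpow hnpos.le hBpos.le, Real.rpow_neg hBpos.le, div_inv_eq_mul, mul_comm]
    calc G x ≤ G (Pi.single 0 (3 * ((L ^ k * r₁ : ℕ) : ℤ))) := hmono'
      _ ≤ A * ((L : ℝ) ^ k) ^ (-(1 + κ)) := hdec k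
      _ ≤ A * (((n : ℝ) / B) ^ (-(1 + κ))) := mul_le_mul_of_nonneg_left h1 hA
      _ = A * B ^ (1 + κ) * (n : ℝ) ^ (-(1 + κ)) := by rw [h2]; ring
      _ ≤ (A * B ^ (1 + κ) + (9 * r₁ : ℝ) ^ (1 + κ)) * (n : ℝ) ^ (-(1 + κ)) := by
          nlinarith

/-- The arithmetic of the chain `c R² G ≤ Cov`, `Cov² ≤ θ^k Var σ₀ Var g`, `Var g ≤ C R³`,
`Var σ₀ ∈ [0,1]`, `G ≥ 0`: `G² ≤ (C'/c²) θ^k / t` for `0 < t ≤ R`, `C ≤ C'`, `0 ≤ C'`. [folklore] -/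
theorem etaFromForgetting_chain_arith {c R G Cov θk V₀ Vg C C' t : ℝ} (hc : 0 < c) (hR : 0 < R)
    (hG : 0 ≤ G) (hθk : 0 ≤ θk) (hV₀ : 0 ≤ V₀ ∧ V₀ ≤ 1) (hCC' : C ≤ C') (hC' : 0 ≤ C')
    (h1 : c * R ^ 2 * G ≤ Cov) (h2 : Cov ^ 2 ≤ θk * V₀ * Vg) (h3 : Vg ≤ C * R ^ 3)
    (ht : 0 < t) (htR : t ≤ R) :
    G ^ 2 ≤ C' / c ^ 2 * θk / t := by
  have hR3 : 0 < R ^ 3 := pow_pos hR 3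
  -- Cov² ≤ θk C' R³
  have hCov2 : Cov ^ 2 ≤ θk * (C' * R ^ 3) := by
    refine h2.trans ?_
    by_cases hVg : 0 ≤ Vg
    · have hVg' : Vg ≤ C' * R ^ 3 := h3.trans (mul_le_mul_of_nonneg_right hCC' hR3.le)
      calc θk * V₀ * Vg = V₀ * (θk * Vg) := by ring
        _ ≤ 1 * (θk * Vg) := mul_le_mul_of_nonneg_right hV₀.2 (mul_nonneg hθk hVg)
        _ = θk * Vg := one_mul _
        _ ≤ θk * (C' * R ^ 3) := mul_le_mul_of_nonneg_left hVg' hθk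
    · push Not at hVg
      calc θk * V₀ * Vg ≤ 0 := mul_nonpos_of_nonneg_of_nonpos (mul_nonneg hθk hV₀.1) hVg.le
        _ ≤ θk * (C' * R ^ 3) := mul_nonneg hθk (mul_nonneg hC' hR3.le)
  have h0 : 0 ≤ c * R ^ 2 * G := mul_nonneg (mul_nonneg hc.le (sq_nonneg R)) hG
  have h4 : (c * R ^ 2 * G) ^ 2 ≤ Cov ^ 2 := pow_le_pow_left₀ h0 h1 2
  have h5 : c ^ 2 * R ^ 4 * G ^ 2 ≤ θk * C' * R ^ 3 := by
    calc c ^ 2 * R ^ 4 * G ^ 2 = (c * R ^ 2 * G) ^ 2 := by ring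
      _ ≤ Cov ^ 2 := h4
      _ ≤ θk * (C' * R ^ 3) := hCov2
      _ = θk * C' * R ^ 3 := by ring
  have h6 : G ^ 2 * (c ^ 2 * R) ≤ C' * θk := by
    refine le_of_mul_le_mul_right ?_ hR3
    calc G ^ 2 * (c ^ 2 * R) * R ^ 3 = c ^ 2 * R ^ 4 * G ^ 2 := by ring
      _ ≤ θk * C' * R ^ 3 := h5
      _ = C' * θk * R ^ 3 := by ring
  have hc2R : 0 < c ^ 2 * R := mul_pos (pow_pos hc 2) hR
  rw [← le_div_iff₀ hc2R] at h6
  have hnum : 0 ≤ C' / c ^ 2 * θk := mul_nonneg (div_nonneg hC' (sq_nonneg c)) hθk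
  calc G ^ 2 ≤ C' * θk / (c ^ 2 * R) := h6
    _ = C' / c ^ 2 * θk * (1 / R) := by
        field_simp
    _ ≤ C' / c ^ 2 * θk * (1 / t) :=
        mul_le_mul_of_nonneg_left (one_div_le_one_div_of_le ht htR) hnum
    _ = C' / c ^ 2 * θk / t := by ring

/-- **`EtaFromForgetting2` (item stmt-CriticalPhenomena-14438 of route `OctaveForgetting`),
proved**: the glue `SphereForgetting → ForgettingComposes → SphereCovarianceLowerBound →
SphereVarianceUpperBound → Target` (middle hypotheses inlined by the render). Fix the plus state
`μ⁺ ∈ 𝒢(β_c(3))` (`exists_plusMeasure_holds`), `r₁ = max r₀ R₀`, `R_k = L^k r₁`,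
`g = ∑_{S_{R_k}} σ_y`: `c²R⁴G(3Re₁)² ≤ Cov² ≤ θ^k Var σ₀ Var g ≤ θ^k C R³`, so
`G(3R_k e₁)² ≤ (C/c²)θ^k/L^k`; `etaFromForgetting_decay_of_geometric` (`θL < 1`) turns this into
`G(3R_k e₁) ≤ A (L^k)^{-(1+κ)}`, `κ > 0`, and `etaFromForgetting_powerlaw_of_axis_decay`
(Messager–Miracle-Solé monotonicity `twoPointFree_le_of_mul_supNorm_le` at `β_c`, plus = free by
`twoPointPlus_criticalBeta_eq_twoPointFree_holds`, `G ≤ 1`) into the `Target`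
`G(x) ≤ C'‖x‖^{-(1+κ)}`, `x ≠ 0`. [folklore] -/
theorem EtaFromForgetting2_proof : OctaveForgetting.EtaFromForgetting2 := by
  unfold OctaveForgetting.EtaFromForgetting2 OctaveForgetting.SphereForgetting
    OctaveForgetting.Target
  intro hSF hFC hCov hVar
  obtain ⟨L, hL, θ, hθ0, hθL, r₀, hr₀, hS⟩ := hSF
  obtain ⟨c, hc, R₀, hR₀, hcov⟩ := hCov
  obtain ⟨C, hvar⟩ := hVar
  -- the plus state is a Gibbs measure at β_c
  obtain ⟨μ, hμ, -, -⟩ :=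
    exists_plusMeasure_holds (d := 3) (β := criticalBeta 3) (h := 0) (criticalBeta_nonneg 3)
  haveI : IsProbabilityMeasure μ := ((mem_isingGibbsMeasures_iff _ _ _ _).1 hμ).isProbabilityMeasure
  set r₁ : ℕ := max r₀ R₀ with hr₁
  have hr₁1 : 1 ≤ r₁ := le_trans hr₀ (le_max_left _ _)
  -- maximal correlations multiply along the shell chain (hypothesis ForgettingComposes)
  have hk := hFC μ hμ L r₁ θ hL hr₁1 hθ0
    (fun r hr f g hf hg => hS r (le_trans (le_max_left _ _) hr) μ hμ f g hf hg)
  -- variance of σ₀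
  have hV₀ := etaFromForgetting_var_spinAt_mem μ 0
  set C' : ℝ := max C 0 with hC'
  have hC'0 : 0 ≤ C' := le_max_right _ _
  have hLpos : (0 : ℝ) < L := by exact_mod_cast (by omega : 0 < L)
  -- the per-scale bound
  have key : ∀ k : ℕ,
      (criticalTwoPoint 3 (Pi.single 0 (3 * ((L ^ k * r₁ : ℕ) : ℤ)))) ^ 2 ≤
        (C' / c ^ 2) * θ ^ k / (L : ℝ) ^ k := by
    intro k
    have hRR₀ : R₀ ≤ L ^ k * r₁ :=
      le_trans (le_max_right r₀ R₀) (Nat.le_mul_of_pos_left _ (pow_pos (by omega) k))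
    have hR1 : 1 ≤ L ^ k * r₁ := le_trans hR₀ hRR₀
    have hRL : (L : ℝ) ^ k ≤ ((L ^ k * r₁ : ℕ) : ℝ) := by
      have : L ^ k ≤ L ^ k * r₁ := Nat.le_mul_of_pos_right _ (by omega)
      exact_mod_cast this
    have hRpos : (0 : ℝ) < ((L ^ k * r₁ : ℕ) : ℝ) := by exact_mod_cast (by omega : 0 < L ^ k * r₁)
    have h1 := hcov (L ^ k * r₁) hRR₀ μ hμ
    have h3 := hvar (L ^ k * r₁) hR1 μ hμ
    have hdep : DependsOn (fun σ : SpinConfig (Site 3) =>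
        ∑ y ∈ (box 3 (L ^ k * r₁)).filter (fun y => ((L ^ k * r₁ : ℕ) : ℤ) ^ 2 ≤ ∑ i, y i ^ 2 ∧
          ∑ i, y i ^ 2 < (((L ^ k * r₁ : ℕ) : ℤ) + 1) ^ 2), spinAt y σ)
        {x : Site 3 | ((L ^ k * r₁ : ℕ) : ℤ) ^ 2 ≤ ∑ i, x i ^ 2 ∧
          ∑ i, x i ^ 2 < (((L ^ k * r₁ : ℕ) : ℤ) + 1) ^ 2} :=
      etaFromForgetting_dependsOn_sum_spinAt _ _ fun y hy => (Finset.mem_filter.1 hy).2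
    have h2 := hk k _ hdep
    have hG0 : 0 ≤ criticalTwoPoint 3 (Pi.single 0 (3 * ((L ^ k * r₁ : ℕ) : ℤ))) :=
      twoPointPlus_nonneg_of_gks (criticalBeta_nonneg 3) _
    have hθk : 0 ≤ θ ^ k := pow_nonneg hθ0 k
    exact etaFromForgetting_chain_arith hc hRpos hG0 hθk hV₀ (le_max_left C 0) hC'0 h1 h2 h3
      (pow_pos hLpos k) hRL
  -- geometric-to-power conversion
  have hD : 0 ≤ C' / c ^ 2 := div_nonneg hC'0 (sq_nonneg c)
  obtain ⟨κ, hκ, A, hA, hdec⟩ := etaFromForgetting_decay_of_geometric hL hθ0 hθL hD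
    (fun k => twoPointPlus_nonneg_of_gks (criticalBeta_nonneg 3) _) key
  -- the power law at every x ≠ 0
  have hmono : ∀ z w : Site 3, 3 * Site.supNorm w ≤ Site.supNorm z →
      criticalTwoPoint 3 z ≤ criticalTwoPoint 3 w := by
    intro z w hzw
    have hpf := twoPointPlus_criticalBeta_eq_twoPointFree_holds (d := 3) le_rfl
    unfold criticalTwoPoint
    rw [hpf z, hpf w]
    exact twoPointFree_le_of_mul_supNorm_le (criticalBeta_nonneg 3) (by norm_num) hzw
  obtain ⟨C₁, hC₁⟩ := etaFromForgetting_powerlaw_of_axis_decay (criticalTwoPoint 3)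
    (fun x => twoPointPlus_le_one_of_nonneg (criticalBeta_nonneg 3) x) hmono hL hr₁1 hA hκ hdec
  exact ⟨κ, C₁, hκ, hC₁⟩

end Summit.CriticalPhenomena.Ising3DConformalLimit.Theorems

end
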